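import Summits.QuantumFields.YangMills.Theses.AspectPurityFloor
import Summits.QuantumFields.YangMills.Theorems.LuscherReductionRunningReductionTraceFormula
import Summits.QuantumFields.YangMills.Theorems.FemtoTransferGapLevelsPos
import Summits.QuantumFields.YangMills.Theorems.FemtoTransferGapBounds
import HarnessLib

/-!
# Route `AspectPurityFloor` (ym-idea-4 g19, LINE g19-A) — the shared registered stub `stub_purityFromFewBody` BY NAME

The M-sized stub shared by BOTH registered BC3 skeletons of the route (`Lines/birth.lean` on ⟨stmt-QuantumFields-23743⟩
`WindowPurityFloor`, namespace `…AspectPurityFloorBirthW`, and on ⟨stmt-QuantumFields-23742⟩ `TailPurityFloor`, `…BirthT`; critic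
idea-crit-4 g11 note K1 «land it ONCE by name»): for `β ≥ 1`, `L ≥ 4`, `t = ⌊L/2⌋`,
`0 ≤ Z_phys(t×L³) ∧ 0 < λ₀ ∧ λ₀^{2t} ≤ Z_phys(2t×L³)` — positivity of the zero-flux thermal trace and the first-term floor of the
trace formula `Σ_k λ_k^{2t} = Z_phys(2t×L³)` (`TT.traceFormula_all`, all terms `≥ 0`).  With it, each skeleton's composition
`WindowPurityFloor_of` / `TailPurityFloor_of` needs only its HARDEST stub (the half-aspect few-body bound).
HONEST FRAMING: closes no crux; `WindowPurityFloor`, `TailPurityFloor`, K1a and the YM gap remain OPEN. No `sorry`, no new axiom.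
[cite: ReedSimonIV1978, Thm. XIII.1] [cite: MontvayMunster1994, (3.145)]
-/

set_option autoImplicit false

noncomputable section

open Summit.QuantumFields.YangMills.Theorems
open Summit.QuantumFields.YangMills.Theorems.FemtoTransferGap

namespace Summit.QuantumFields.YangMills.Theses.AspectPurityFloor

/-- ★ `stub_purityFromFewBody` of both birth skeletons, verbatim statement: for `β ≥ 1`, `L ≥ 4`:
`0 ≤ Z_phys(⌊L/2⌋×L³)`, `0 < λ₀`, `λ₀^{2⌊L/2⌋} ≤ Z_phys(2⌊L/2⌋×L³)`. [cite: ReedSimonIV1978, Thm. XIII.1] -/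
theorem purityFromFewBody : ∀ (L : ℕ) [NeZero L] (β : ℝ), 1 ≤ β → 4 ≤ L →
    0 ≤ Summit.QuantumFields.YangMills.Theorems.FemtoTransferGap.TT.physTrace L β (L / 2) ∧
    0 < Summit.QuantumFields.YangMills.Theorems.FemtoTransferGap.levelValue
          Summit.QuantumFields.YangMills.Theorems.FemtoTransferGap.su2Rep L β 0 ∧
    Summit.QuantumFields.YangMills.Theorems.FemtoTransferGap.levelValue
        Summit.QuantumFields.YangMills.Theorems.FemtoTransferGap.su2Rep L β 0 ^ (2 * (L / 2)) ≤
      Summit.QuantumFields.YangMills.Theorems.FemtoTransferGap.TT.physTrace L β (2 * (L / 2)) := by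
  intro L _ β hβ hL
  have hβ0 : 0 < β := by linarith
  have hl0 : 0 < levelValue su2Rep L β 0 := levelValue_zero_su2Rep_pos L β
  have hlpos : ∀ k, 0 < levelValue su2Rep L β k := fun k => levelValue_su2Rep_pos hβ0 k
  have hSt : HasSum (fun k => levelValue su2Rep L β k ^ (L / 2)) (TT.physTrace L β (L / 2)) :=
    TT.traceFormula_all L β (L / 2) hβ (by omega)
  have hS2t : HasSum (fun k => levelValue su2Rep L β k ^ (2 * (L / 2))) (TT.physTrace L β (2 * (L / 2))) :=
    TT.traceFormula_all L β (2 * (L / 2)) hβ (by omega)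
  refine ⟨?_, hl0, ?_⟩
  · exact le_trans (pow_nonneg hl0.le _) (le_hasSum hSt 0 (fun j _ => pow_nonneg (hlpos j).le _))
  · exact le_hasSum hS2t 0 (fun j _ => pow_nonneg (hlpos j).le _)

/-- The registered stub statement `PurityFromFewBodyP` of line `birth` of cruxes ⟨stmt-QuantumFields-23743⟩ / ⟨23742⟩ (verbatim copy of
the skeletons' `AspectPurityFloorBirthW.PurityFromFewBodyP` = `AspectPurityFloorBirthT.PurityFromFewBodyP`; a registered-stub copy, not a
citable fact; proved below as `stub_purityFromFewBody`). -/
abbrev PurityFromFewBodyP : Prop :=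
  ∀ (L : ℕ) [NeZero L] (β : ℝ), 1 ≤ β → 4 ≤ L →
    0 ≤ Summit.QuantumFields.YangMills.Theorems.FemtoTransferGap.TT.physTrace L β (L / 2) ∧
    0 < Summit.QuantumFields.YangMills.Theorems.FemtoTransferGap.levelValue
          Summit.QuantumFields.YangMills.Theorems.FemtoTransferGap.su2Rep L β 0 ∧
    Summit.QuantumFields.YangMills.Theorems.FemtoTransferGap.levelValue
        Summit.QuantumFields.YangMills.Theorems.FemtoTransferGap.su2Rep L β 0 ^ (2 * (L / 2)) ≤
      Summit.QuantumFields.YangMills.Theorems.FemtoTransferGap.TT.physTrace L β (2 * (L / 2))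

/-- ★ **Registered stub `stub_purityFromFewBody` — CLOSED** (both skeletons, verbatim header). [cite: ReedSimonIV1978, Thm. XIII.1] -/
theorem stub_purityFromFewBody : PurityFromFewBodyP := purityFromFewBody

end Summit.QuantumFields.YangMills.Theses.AspectPurityFloor

end
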